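import Literature.MathematicalPhysics.QuantumFieldTheory.Balaban1983to89.B9CubeGeometryInputs

/-!
# `Balaban1983to89.B9Cor35GpCubeInputsAtOne` — [Balaban1985BackgroundPropagators] Corollary 3.5 p. 407 («for U = 1 these theorems are proved in [4]»)
# FOR THE CUBE LETTER `G′_□`: THE `U = 1` BINDERS OF `B9Thm34SectBUniformR1.thm34_Gp_uniform` AT THE CUBE GEOMETRY `geoCK i □` — the letters
# `Δp = conj b(η⁻²Δ′_{a,□}(1))`, `Gp = conj b(η²G′_□(1))` and their unit laws; the (3.19)/(3.24) size binders `hw, hcard, hkQ, hsQ, hcfun`;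
# and THEOREM 3.1 (3.42)₁₋₃ AT `U = 1` IN CONJ-`b` FORM FOR ALL BOND ORIENTATIONS `k : κ ⊕ κ` (`h342_1, h342_2, h342_3`) from r05's scalar
# [4] Prop. 2.2 majorants of `GpCubeW` (M5.1a), the two unprinted orientations `∇*_μG′_□`, `G′_□∇_μ` by the one-step shift in [4]'s majorant
# calculus — sub-row G-B9-LETTERS, module M5.1b-G′ (site sector), FILE 5b of seat p33's plan

statement-level skeleton of published theorems with citation tags; proofs where landed; nothing here is a claim about the Yang–Mills mass gap

CITATION HEADER (lean-in-tree rule).  B9 = T. Bałaban, *Propagators for lattice gauge theories in a background field*, Commun. Math. Phys. **99** (1985)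
389–434 [Balaban1985BackgroundPropagators] (held `paper:balaban1985-cmp99-background-propagators`; journal page = PDF page + 388): Cor. 3.5 p. 407 l. 26–31
«The theorems hold also for the operators (3.24), (3.25) and (3.30), (3.31) … with the same vector potentials and with U = 1, these theorems were
proved in [4]»; p. 409 l. 1–5 (the cube letters «satisfy all the inequalities of Theorems 3.1–3.3»); Thm 3.1 (3.42) p. 397 «|(G′(U)λ)(x)|, |(∇_UG′(U)λ)(x)|,
|(G′(U)∇*_Uλ)(x)|, … ≦ B₀[(Lʲη)², Lʲη, Lʲη, 1]e^{−δ₀d(y,y′)}|λ|»; (3.3) p. 390, (3.8) p. 392 (both orientations `D_{U,μ}`, `D*_{U,μ}`); (3.19) p. 393;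
(3.24)–(3.25) pp. 394–395; (3.39)–(3.41) p. 397; p. 398 remark after (3.47) (scale transfer).  [4] = [Balaban1984PropagatorsII] Prop. 2.2 (2.67) p. 234,
(2.51)–(2.55) pp. 232–233, (2.60)–(2.63) p. 234, (2.65) p. 234.  Rows B9.Thm3.1 × B9.Cor3.5 (cells only; no row head changes).

WHY THIS FILE (cell lit-balaban, sub-row G-B9-LETTERS, module M5.1b-G′ booked to seat p33 g96; memo `lit-balaban-p33/COR35GP-STATEMENTS-p33.md` §2).
Sect. B's engine `thm34_Gp_uniform` — to be applied at `U := 1`, `g := geoCK i □`, `A := χ̃_□·A` (FILE 6) — asks at the base: the letters `Δp`, `Gp` of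
`Module.End ℝ (S × ι → ℝ)` with `Δp·Gp = 1 = Gp·Δp`; the size binders of the averaging kernels; and Theorem 3.1 (3.42)₁₋₃ for `Gp` in the block-majorant
currency of [4] for ALL `k : κ ⊕ κ`: `Gp ≺ B_G(Lⁿη)²e^{−δ₀d}`, `conj b(∇_k)·Gp ≺ B_G(Lⁿη)e^{−δ₀d}`, `Gp·conj b(∇_k) ≺ B_G(Lⁿη)e^{−δ₀d}`.  M5.1a (r05,
`B9Thm31CubeLocalFlat.thm31_cubeW_flat_first/second/third`) certifies the three PRINTED orientations for the scalar matrix `GpCubeW = G′_□(1)` over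
N03's `geomT (cubeFam …)`; `B9CubeLettersOpsL0.GpCubeY_one_liftY` says `G′_□(1)(f ⊗ E) = (GpCubeW f) ⊗ E`.  THIS FILE lifts scalar block majorants
through `conj b` for coordinate-diagonal operators (§1), builds the letters and laws (§2), the sizes (§3), the three printed entries (§4), and derives
the two unprinted orientations `∇*_μG′_□ = −σ_{−e_μ}(∇_μG′_□)` and `G′_□∇_μ = −(G′_□∇*_μ)σ_{e_μ}` (§5) by the one-step translation's block majorant
`e^{θ}e^{−θd}` (FILE 5a's stencil), [4]'s product rule (2.52), the p. 398 scale transfer and (2.61)/(2.63) — the member chain takes these as the named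
hypothesis `Read342Y` (`B9SectBGpFrameCodedY`); here they are PROVED for the cube letter at `U = 1`.

WHAT IS PROVED (5 `def`s with bodies — `DpK`, `GpK`, `wK`, `cfunK`, abbrev `GpW`; 0 sorry; 0 new named facts; standard axioms):
* §1 `liftY_smul ∕ liftY_neg`, `coordEquiv_symm_eq_sum_liftY`, ★`conj_apply_of_liftY` (`(conj b T μ)(x,i) = (m μ(·,i))(x)` when `T(f ⊗ E) = (mf) ⊗ E`),
  ★★`hasMajorant_conj_of_liftY` (`m ≺ K ⟹ conj b T ≺ K`), `hasMajorant_smul`, `hasMajorant_neg`;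
* §2 `DpK`, `GpK`, `eta_ne_zero`, `conj_one'`, ★`DpK_mul_GpK` (binders `hΔpGp`, `hGpΔp`; r05's `isUnit_deltaPrimeACubeY_one`);
* §3 `wK`, `cfunK`, `wK_nonneg` (`hw`), ★`card_block_mul_wK_le` (`hcard`, `card_blkOf_le`), `norm_Rclm_one_le`, ★`norm_kQCubeY_one_le` (`hkQ`),
  `norm_sQCubeY_one_le` (`hsQ`), `cCubeY_eq`, ★`abs_cfunK_le` (`hcfun`: `|cfun| ≤ 1·(Lⁿη)⁻²`, `0 ≦ a_n ≦ a₀ = 1`);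
* §4 `hasMajorant_toB6_of_geomT`, `smul_GpCubeY_one_liftY`, `gradLetterF_one_liftY`, `gradLetterB_one_liftY` (`∇_μ(g⊗E) = (η⁻¹∂_μg)⊗E`, `∂ᵀ` for `∇*`),
  `len_reshape`, ★★`h342_1_cube`, ★★`h342_2_cube_inl`, ★★`h342_3_cube_inr` (the printed orientations, from r05's shapes VERBATIM), ★`h342_2_cube_inr`,
  ★`h342_3_cube_inl` (the unprinted ones, from scalar majorants of `∂_μᵀ·GpCubeW`, `GpCubeW·∂_μ` over `toB6 (geoCK i □)`);
* §5 ★`hasMajorant_shiftMat` (`σ_{±e_μ} ≺ e^{θ}e^{−θd}`), `tshift_neg_tshift`, `toLin'_transpose_dT_mul`, `toLin'_mul_dT` (the operator identities),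
  ★`hasMajorant_shift_mul_weighted` (shift ∘ weighted kernel: scale transfer + (2.54) + (2.63)), `transfer_pow_of_scaleTransfer`,
  ★★`hasMajorant_transpose_dT_mul_GpW` (backward-left from forward-left: constant `e^{δ}CΛc₁²`, rate `(1−α′)(1−α)δ`), ★★`hasMajorant_GpW_mul_dT`
  (forward-right from backward-right: `B6RandomWalk.majorant_G0_mul_265`, constant `Cc₁e^{(1−α)δ}`, rate `(1−α)δ`).

PROOF.  Ours (bookkeeping over certified inputs); [4]'s majorant calculus as typed in `B6RandomWalk`; no step of print is skipped — print's Cor. 3.5 defers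
the `U = 1` case to [4], and [4]'s Prop. 2.2 is orientation-blind; the shift derivation is the one-line remark that `∇* = −σ⁻¹∇` on the torus.

HONEST SCOPE / NOT CLAIMED.  `U = 1` only (the flat member datum of `thm34_Gp_uniform`); the (3.43) Hölder and (3.46)–(3.47) entries are not touched; the
rates degrade by the factors `(1−α)`, `(1−α′)` of the (2.54)/(2.63) bookkeeping (all constants are ∃-constants downstream); Thm 3.1's scalar inputs are
HYPOTHESES of the displayed r05 shapes here (FILE 6 feeds `thm31_cubeW_flat_*`); nothing on `d = 4`, the continuum, reflection positivity or the mass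
gap; NOT a node discharge; no row head changes.

RELATED IN THE TREE, NOT DUPLICATED: n06-c's `B9SectBGpLettersY.ΔpC/GopC/ΔpC_mul_GopC` (the member's letters over the coded carrier — same template, other
letter), p21's `B9CubeLettersInvReadDict.hasMajorant_*_of_eBlockInv` (EBlock → conj-b majorants at a general `U`, printed orientations), r03-lineage's
`B9Thm39CinvUpperL.hasMajorant_mul_weighted` (a sibling composition rule, not in this cone).
-/

noncomputable section

namespace Literature.MathematicalPhysics.QuantumFieldTheory.Balaban1983to89.B9Cor35GpCubeInputsAtOne

open Literature.MathematicalPhysics.QuantumFieldTheory.Balaban1983to89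
open Literature.MathematicalPhysics.QuantumFieldTheory.Balaban1983to89.B6RandomWalk (HasMajorant BlockSupp hasMajorant_mono)
open Literature.MathematicalPhysics.QuantumFieldTheory.Balaban1983to89.B9Thm34Ext (toB6)
open Literature.MathematicalPhysics.QuantumFieldTheory.Balaban1983to89.B9Eq352DivFormLetters (conj conj_apply coordEquiv coordEquiv_symm_apply conj_neg gradLetterF
  gradLetterB)
open Literature.MathematicalPhysics.QuantumFieldTheory.Balaban1983to89.B9Eq352GradLetters (diffLetter diffLetter_inl diffLetter_inr)
open Literature.MathematicalPhysics.QuantumFieldTheory.Balaban1983to89.B9Eq39Adjoint (R R_one covD covDstar)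
open Literature.MathematicalPhysics.QuantumFieldTheory.Balaban1983to89.B6KLevelCensusIndexV1 (KIdx kGeo)
open Literature.MathematicalPhysics.QuantumFieldTheory.Balaban1983to89.B6Cover236MultiLevelBlocks (cubes)
open Literature.MathematicalPhysics.QuantumFieldTheory.Balaban1983to89.B6MultiLevelTorusOperator (tshift tshift_symm_apply unitVec shiftMat shiftMat_mulVec
  shiftMat_neg)
open Literature.MathematicalPhysics.QuantumFieldTheory.Balaban1983to89.B6Prop22DerivMultiLevelTorus (dT dT_mulVec)
open Literature.MathematicalPhysics.QuantumFieldTheory.Balaban1983to89.B6Ineq268MultiLevelBoxL0 (W W_pos W_eq card_blkOf_le)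
open Literature.MathematicalPhysics.QuantumFieldTheory.Balaban1983to89.B6Geom246MultiLevelBoxL0 (blkOf)
open Literature.MathematicalPhysics.QuantumFieldTheory.Balaban1983to89.B6MultiLevelBoxOperator (levC)
open Literature.MathematicalPhysics.QuantumFieldTheory.Balaban1983to89.B9Thm31CubeLocalFlat (wCube wCube_window GpCubeW)
open Literature.MathematicalPhysics.QuantumFieldTheory.Balaban1983to89.B9CubeLettersOpsL0 (oddMh cubeFamY levCubeY deltaPrimeACubeY GpCubeY GpCubeY_one_liftY
  deltaPrimeACubeY_mul_GpCubeY GpCubeY_mul_deltaPrimeACubeY isUnit_deltaPrimeACubeY_one)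
open Literature.MathematicalPhysics.QuantumFieldTheory.Balaban1983to89.B9CubeLettersBondOpsL0 (BlkCubeY blkCornerCubeY)
open Literature.MathematicalPhysics.QuantumFieldTheory.Balaban1983to89.B9Eq360DeltaPrimeAY (Rclm Rclm_apply)
open Literature.MathematicalPhysics.QuantumFieldTheory.Balaban1983to89.B9Eq360DeltaPrimeACubeY (blkCubeY blkCubeY_apply kQCubeY sQCubeY cCubeY kQCubeY_apply
  sQCubeY_apply)
open Literature.MathematicalPhysics.QuantumFieldTheory.Balaban1983to89.B9CubeGeometryInputs (geoCK geoCK_len geoCK_eta geoCK_eta_pos geoCK_L geoCK_dist)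
open Literature.MathematicalPhysics.QuantumFieldTheory.Balaban1983to89.Node00 (SiteY CfgY SiteParY toKT shiftY liftY liftY_apply)
open scoped Matrix

variable {d ℓ : ℕ} {hd : 1 ≤ d + 1} {hL : Odd (ℓ + 1) ∧ 1 < ℓ + 1} {b₀ b₁ : ℝ}

/-! ## §1  Block majorants of `conj b T` for an operator `T` acting through a real operator on the coordinates (`T(f ⊗ E) = (mf) ⊗ E`) -/

section Lift

variable {𝔸 : Type} [NormedRing 𝔸] [NormedAlgebra ℂ 𝔸] [CompleteSpace 𝔸]
variable {ι : Type} [Fintype ι] (b : Module.Basis ι ℝ 𝔸)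
variable {S : Type}

omit [CompleteSpace 𝔸] in
/-- `r·(f ⊗ E) = (r f) ⊗ E`. [cite: Balaban1985BackgroundPropagators, (3.39) p.397, bookkeeping] -/
theorem liftY_smul (r : ℝ) (f : S → ℝ) (E : 𝔸) : liftY (r • f) E = r • liftY f E := by
  funext z
  simp only [liftY_apply, Pi.smul_apply, smul_eq_mul, Complex.ofReal_mul, mul_smul, Complex.coe_smul]

omit [CompleteSpace 𝔸] in
/-- `(−f) ⊗ E = −(f ⊗ E)`. [cite: Balaban1985BackgroundPropagators, (3.39) p.397, bookkeeping] -/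
theorem liftY_neg (f : S → ℝ) (E : 𝔸) : liftY (-f) E = -liftY f E := by
  funext z
  simp only [liftY_apply, Pi.neg_apply, Complex.ofReal_neg, neg_smul]

omit [CompleteSpace 𝔸] in
/-- the inverse coordinates are a sum of product vectors: `coord⁻¹μ = Σ_i μ(·, i) ⊗ b_i`. [cite: Balaban1984PropagatorsII, (2.51) p.232, bookkeeping] -/
theorem coordEquiv_symm_eq_sum_liftY (μ : S × ι → ℝ) : (coordEquiv b).symm μ = ∑ j, liftY (fun x => μ (x, j)) (b j) := by
  funext x
  rw [coordEquiv_symm_apply, Finset.sum_apply]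
  refine Finset.sum_congr rfl fun j _ => ?_
  rw [liftY_apply, Complex.coe_smul]

omit [CompleteSpace 𝔸] in
/-- ★ **`conj b T` OF A COORDINATE-DIAGONAL OPERATOR**: if `T(f ⊗ E) = (m f) ⊗ E` for a real operator `m`, then `(conj b T μ)(x, i) = (m μ(·, i))(x)`.
[cite: Balaban1984PropagatorsII, (2.51) p.232 («the operators … act on each coordinate»); Balaban1985BackgroundPropagators, Cor. 3.5 p.407 (U = 1)] -/
theorem conj_apply_of_liftY (T : Module.End ℝ (S → 𝔸)) (m : Module.End ℝ (S → ℝ)) (hT : ∀ (f : S → ℝ) (E : 𝔸), T (liftY f E) = liftY (m f) E)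
    (μ : S × ι → ℝ) (p : S × ι) : conj b T μ p = m (fun x => μ (x, p.2)) p.1 := by
  rw [conj_apply, coordEquiv_symm_eq_sum_liftY, map_sum]
  simp only [hT]
  rw [Finset.sum_apply]
  simp only [liftY_apply, Complex.coe_smul]
  rw [show (∑ j, (m (fun x => μ (x, j)) p.1) • b j) = b.equivFun.symm (fun j => m (fun x => μ (x, j)) p.1) by
    rw [Module.Basis.equivFun_symm_apply]]
  rw [← Module.Basis.equivFun_apply, LinearEquiv.apply_symm_apply]

omit [CompleteSpace 𝔸] in
/-- ★★ **BLOCK MAJORANTS LIFT FROM THE COORDINATE OPERATOR**: if `T(f ⊗ E) = (mf) ⊗ E` and `m ≺ K` on the blocks, then `conj b T ≺ K` on the blocks read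
through the first coordinate. [cite: Balaban1984PropagatorsII, (2.51) p.232; Balaban1985BackgroundPropagators, Cor. 3.5 p.407 («with … U = 1, these theorems are proved in [4]»)] -/
theorem hasMajorant_conj_of_liftY {g : B6.Geometry} (blk : S → g.Site) (T : Module.End ℝ (S → 𝔸)) (m : Module.End ℝ (S → ℝ))
    (hT : ∀ (f : S → ℝ) (E : 𝔸), T (liftY f E) = liftY (m f) E) {K : g.Site → g.Site → ℝ} (hm : HasMajorant (g := g) blk m K) :
    HasMajorant (g := g) (fun p : S × ι => blk p.1) (conj b T) K := by
  intro y' μ B hμ p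
  rw [conj_apply_of_liftY b T m hT]
  exact hm y' (fun x => μ (x, p.2)) B ⟨hμ.nonneg, fun x hx => hμ.bound (x, p.2) hx, fun x hx => hμ.off (x, p.2) hx⟩ p.1

/-- a scalar multiple scales the majorant. [cite: Balaban1984PropagatorsII, (2.52) p.232, bookkeeping] -/
theorem hasMajorant_smul {g : B6.Geometry} (blk : S → g.Site) {m : Module.End ℝ (S → ℝ)} {K : g.Site → g.Site → ℝ}
    (hm : HasMajorant (g := g) blk m K) (r : ℝ) : HasMajorant (g := g) blk (r • m) (fun a a' => |r| * K a a') := by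
  intro y' μ B hμ x
  rw [LinearMap.smul_apply, Pi.smul_apply, smul_eq_mul, abs_mul, mul_assoc]
  exact mul_le_mul_of_nonneg_left (hm y' μ B hμ x) (abs_nonneg r)

/-- a negation keeps the majorant. [cite: Balaban1984PropagatorsII, (2.52) p.232, bookkeeping] -/
theorem hasMajorant_neg {X : Type} {g : B6.Geometry} (blk : X → g.Site) {T : Module.End ℝ (X → ℝ)} {K : g.Site → g.Site → ℝ}
    (h : HasMajorant (g := g) blk T K) : HasMajorant (g := g) blk (-T) K := by
  intro y' μ B hμ x
  rw [LinearMap.neg_apply, Pi.neg_apply, abs_neg]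
  exact h y' μ B hμ x

end Lift

/-! ## §2  The cube letters at `U = 1` in print's units and real coordinates: `Δp = conj b(η⁻²Δ′_{a,□}(1))`, `Gp = conj b(η²G′_□(1))` -/

section Letters

variable {𝔸 : Type} [NormedRing 𝔸] [NormedAlgebra ℂ 𝔸] [CompleteSpace 𝔸]
variable {ι : Type} [Fintype ι] (b : Module.Basis ι ℝ 𝔸)
variable (i : KIdx d ℓ hd hL b₀ b₁) (c : ↥(cubes (toKT i).D.toDomains)) (par : SiteParY 𝔸 i)

/-- **the letter `Δp = Δ′_{a,□}(1)`** of `thm34_Gp_uniform` at the cube, print's units (`η⁻²` × NODE 00's lattice-unit operator), real coordinates.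
[cite: Balaban1985BackgroundPropagators, (3.24) p.394, p.409 («G′_□»), Cor. 3.5 p.407 (U = 1)] -/
def DpK : Module.End ℝ (SiteY i × ι → ℝ) :=
  conj b (((kGeo i).eta ^ 2)⁻¹ • (deltaPrimeACubeY i c par (fun _ _ => 1)).restrictScalars ℝ)

/-- **the letter `Gp = G′_□(1)`** of `thm34_Gp_uniform` at the cube, print's units (`η²` × r05's `GpCubeY … 1`), real coordinates.
[cite: Balaban1985BackgroundPropagators, (3.25) p.395, p.409 («G′_□(U)»), Cor. 3.5 p.407 (U = 1)] -/
def GpK : Module.End ℝ (SiteY i × ι → ℝ) :=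
  conj b (((kGeo i).eta ^ 2) • (GpCubeY i c par (fun _ _ => 1)).restrictScalars ℝ)

/-- `η ≠ 0`. [cite: Balaban1984PropagatorsII, (2.1) p.224, bookkeeping] -/
theorem eta_ne_zero : (kGeo i).eta ≠ 0 := by
  show |i.cf|⁻¹ ≠ 0
  exact inv_ne_zero (abs_ne_zero.2 i.hcf)

omit [CompleteSpace 𝔸] in
/-- `conj b 1 = 1`. [cite: Balaban1984PropagatorsII, (2.51) p.232, bookkeeping] -/
theorem conj_one' {S : Type} : conj (S := S) b (1 : Module.End ℝ (S → 𝔸)) = 1 := LinearEquiv.conj_id _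

/-- ★ **THE BINDERS `hΔpGp`, `hGpΔp` OF `thm34_Gp_uniform` AT THE CUBE**: `Δp·Gp = 1 = Gp·Δp` at `U = 1` (r05's `isUnit_deltaPrimeACubeY_one`, any transporter
letter with `par 1 = 1`). [cite: Balaban1985BackgroundPropagators, (3.24)–(3.25) pp.394–395, Cor. 3.5 p.407, p.409] -/
theorem DpK_mul_GpK (hpar : ∀ z w, par (fun _ _ => 1) z w = 1) :
    DpK b i c par * GpK b i c par = 1 ∧ GpK b i c par * DpK b i c par = 1 := by
  have hη2 : ((kGeo i).eta ^ 2 : ℝ) ≠ 0 := pow_ne_zero 2 (eta_ne_zero i)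
  have hunit := isUnit_deltaPrimeACubeY_one i c par hpar
  constructor
  · rw [DpK, GpK, ← B9Eq352DivFormLetters.conj_mul, smul_mul_smul_comm, inv_mul_cancel₀ hη2, one_smul, Module.End.mul_eq_comp, ← LinearMap.restrictScalars_comp,
      ← Module.End.mul_eq_comp, deltaPrimeACubeY_mul_GpCubeY i c par _ hunit]
    exact conj_one' b
  · rw [DpK, GpK, ← B9Eq352DivFormLetters.conj_mul, smul_mul_smul_comm, mul_inv_cancel₀ hη2, one_smul, Module.End.mul_eq_comp, ← LinearMap.restrictScalars_comp,
      ← Module.End.mul_eq_comp, GpCubeY_mul_deltaPrimeACubeY i c par _ hunit]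
    exact conj_one' b

end Letters

/-! ## §3  The (3.19) ∕ (3.24) size binders `hw`, `hcard`, `hkQ`, `hsQ`, `hcfun` at `U = 1` for FILE 1's letters -/

section Sizes

variable {𝔸 : Type} [NormedRing 𝔸] [NormedAlgebra ℂ 𝔸] [CompleteSpace 𝔸]
variable (i : KIdx d ℓ hd hL b₀ b₁) (c : ↥(cubes (toKT i).D.toDomains)) (par : SiteParY 𝔸 i)

/-- **the (3.19) weight `w(s) = W(s)⁻¹`** (`L^{−n(s)(d+1)}`). [cite: Balaban1985BackgroundPropagators, (3.19) p.393] -/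
def wK (s : BlkCubeY i c) : ℝ := (W (cubeFamY i c).toDomains s)⁻¹

/-- **the (3.24) letter `cfun(s) = η⁻²·c_□(s) = a_{n(s)}(L^{n(s)}η)⁻²`.** [cite: Balaban1985BackgroundPropagators, (3.24) p.394; Balaban1984PropagatorsII, (2.14) p.225] -/
def cfunK (s : BlkCubeY i c) : ℝ := ((kGeo i).eta ^ 2)⁻¹ * cCubeY i c s

/-- binder `hw`: `0 ≤ w`. [cite: Balaban1985BackgroundPropagators, (3.19) p.393, bookkeeping] -/
theorem wK_nonneg (s : BlkCubeY i c) : 0 ≤ wK i c s := inv_nonneg.2 (W_pos _ s).le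

/-- binder `hcard` ((3.19): «Σ_{x∈Bʲ(y)} L^{−jd} = 1»): `#block(s)·w(s) ≤ 1`. [cite: Balaban1985BackgroundPropagators, (3.19) p.393; Balaban1984PropagatorsII, (2.69) p.235] -/
theorem card_block_mul_wK_le (s : BlkCubeY i c) : ((B9Eq360Vprime.block (blkCubeY i c) s).card : ℝ) * wK i c s ≤ 1 := by
  classical
  have hW := W_pos (cubeFamY i c).toDomains s
  have hset : B9Eq360Vprime.block (blkCubeY i c) s = Finset.univ.filter (fun x => blkOf (cubeFamY i c).toDomains x = s) := by
    ext x; simp only [B9Eq360Vprime.block, Finset.mem_filter, Finset.mem_univ, true_and, blkCubeY_apply]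
  have hc : ((B9Eq360Vprime.block (blkCubeY i c) s).card : ℝ) ≤ W (cubeFamY i c).toDomains s := by
    rw [hset]; exact card_blkOf_le (cubeFamY i c).toDomains s
  rw [wK, ← div_eq_mul_inv, div_le_one hW]
  exact hc

omit [CompleteSpace 𝔸] in
/-- `‖R(1)‖ ≤ 1` as a CLM (from `‖1‖ ≤ 1`). [cite: Balaban1985BackgroundPropagators, (3.1) p.390, bookkeeping] -/
theorem norm_Rclm_one_le (h1 : ‖(1 : 𝔸)‖ ≤ 1) : ‖Rclm (1 : 𝔸ˣ)‖ ≤ 1 := by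
  refine (ContinuousLinearMap.opNorm_mulLeftRight_apply_apply_le ℝ 𝔸 _ _).trans ?_
  rw [inv_one, Units.val_one]
  exact mul_le_one₀ h1 (norm_nonneg _) h1

/-- binder `hkQ` ((3.19) «|Q′-kernel| ≦ L^{−jd}»): `‖kQ(1; s, w)‖ ≤ w(s)` for a transporter letter with `par 1 = 1`. [cite: Balaban1985BackgroundPropagators, (3.19) p.393] -/
theorem norm_kQCubeY_one_le (h1 : ‖(1 : 𝔸)‖ ≤ 1) (hpar : ∀ z w, par (fun _ _ => 1) z w = 1) (s : BlkCubeY i c) (w : SiteY i) :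
    ‖kQCubeY i c par (fun _ _ => 1) s w‖ ≤ wK i c s := by
  show ‖(W (cubeFamY i c).toDomains s)⁻¹ • Rclm (par (fun _ _ => 1) (blkCornerCubeY i c s) w)‖ ≤ wK i c s
  rw [hpar, norm_smul, Real.norm_eq_abs, abs_of_nonneg (inv_nonneg.2 (W_pos _ s).le)]
  exact mul_le_of_le_one_right (inv_nonneg.2 (W_pos _ s).le) (norm_Rclm_one_le h1)

/-- binder `hsQ`: `‖sQ(1; z)‖ ≤ 1`. [cite: Balaban1985BackgroundPropagators, (3.24) p.394, (3.19) p.393] -/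
theorem norm_sQCubeY_one_le (h1 : ‖(1 : 𝔸)‖ ≤ 1) (hpar : ∀ z w, par (fun _ _ => 1) z w = 1) (z : SiteY i) :
    ‖sQCubeY i c par (fun _ _ => 1) z‖ ≤ 1 := by
  show ‖Rclm (par (fun _ _ => 1) z (blkCornerCubeY i c (blkCubeY i c z)))‖ ≤ 1
  rw [hpar]; exact norm_Rclm_one_le h1

/-- `c_□(s) = a_{n(s)}·L^{−2n(s)}` (`levC·W`). [cite: Balaban1984PropagatorsII, (2.14) p.225, bookkeeping] -/
theorem cCubeY_eq (s : BlkCubeY i c) : cCubeY i c s = wCube ℓ s.1.1 * ((((ℓ : ℝ) + 1) ^ s.1.1) ^ 2)⁻¹ := by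
  unfold cCubeY levC
  rw [W_eq]
  have h0 : ((((ℓ : ℝ) + 1) ^ s.1.1) ^ (d + 1)) ≠ 0 := by positivity
  field_simp

/-- binder `hcfun` ((3.24) «0 ≦ a_j ≦ a₀», `a₀ = 1`): `|cfun(s)| ≤ 1·(L^{n(s)}η)⁻²`. [cite: Balaban1985BackgroundPropagators, (3.24) p.394; Balaban1984PropagatorsII, (2.14) p.225] -/
theorem abs_cfunK_le (s : BlkCubeY i c) : |cfunK i c s| ≤ 1 * ((geoCK i c).len s ^ 2)⁻¹ := by
  have hℓ : 1 ≤ ℓ := by have := hL.2; omega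
  obtain ⟨hlo, hhi⟩ := wCube_window (ℓ := ℓ) hℓ s.1.1
  have hw0 : 0 ≤ wCube ℓ s.1.1 := le_trans (by
    have : (1 : ℝ) ≤ ((ℓ : ℝ) + 1) ^ 2 := one_le_pow₀ (by linarith [(Nat.cast_nonneg ℓ : (0 : ℝ) ≤ ℓ)])
    have := inv_le_one_of_one_le₀ this
    linarith) hlo
  have hη := geoCK_eta_pos i c
  rw [cfunK, cCubeY_eq, geoCK_len, one_mul]
  rw [show ((kGeo i).eta ^ 2)⁻¹ * (wCube ℓ s.1.1 * ((((ℓ : ℝ) + 1) ^ s.1.1) ^ 2)⁻¹) =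
      wCube ℓ s.1.1 * (((((ℓ : ℝ) + 1) ^ s.1.1) * (kGeo i).eta) ^ 2)⁻¹ by rw [mul_pow, mul_inv]; ring]
  rw [abs_of_nonneg (mul_nonneg hw0 (inv_nonneg.2 (sq_nonneg _)))]
  exact mul_le_of_le_one_left (inv_nonneg.2 (sq_nonneg _)) hhi

end Sizes

/-! ## §4  Theorem 3.1 (3.42)₁₋₃ at `U = 1` for `G′_□` in the conj-`b` form of `thm34_Gp_uniform` (binders `h342_1`, `h342_2`, `h342_3`) -/

section Entries

variable {𝔸 : Type} [NormedRing 𝔸] [NormedAlgebra ℂ 𝔸] [CompleteSpace 𝔸]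
variable {ι : Type} [Fintype ι] (b : Module.Basis ι ℝ 𝔸)
variable (i : KIdx d ℓ hd hL b₀ b₁) (c : ↥(cubes (toKT i).D.toDomains)) (par : SiteParY 𝔸 i)

/-- r05's scalar cube letter `GpCubeW` at def-Y's member. [cite: Balaban1985BackgroundPropagators, p.409, dictionary] -/
abbrev GpW : Matrix (SiteY i) (SiteY i) ℝ := GpCubeW (toKT i).D c hL.1 (oddMh i) (toKT i).hMh (toKT i).hP

/-- block majorants are the same statement over N03's `geomT (cubeFamY i □)` and over `toB6 (geoCK i □) Rr H` (same sites).
[cite: Balaban1984PropagatorsII, (2.51) p.232, bookkeeping] -/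
theorem hasMajorant_toB6_of_geomT {X : Type} {blk : X → BlkCubeY i c} {T : Module.End ℝ (X → ℝ)} {K : BlkCubeY i c → BlkCubeY i c → ℝ} (Rr : ℝ) (H : Prop)
    (h : HasMajorant (g := B6Geom246MultiLevelTorusL0.geomT (cubeFamY i c)) blk T K) : HasMajorant (g := toB6 (geoCK i c) Rr H) blk T K :=
  fun y' μ B hμ x => h y' μ B ⟨hμ.nonneg, hμ.bound, hμ.off⟩ x

/-- `η²G′_□(1)(f ⊗ E) = (η²·G′_□f) ⊗ E` (r05's `GpCubeY_one_liftY`). [cite: Balaban1985BackgroundPropagators, Cor. 3.5 p.407, p.409] -/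
theorem smul_GpCubeY_one_liftY (hpar : ∀ z w, par (fun _ _ => 1) z w = 1) (f : SiteY i → ℝ) (E : 𝔸) :
    (((kGeo i).eta ^ 2) • (GpCubeY i c par (fun _ _ => 1)).restrictScalars ℝ) (liftY f E) = liftY (((kGeo i).eta ^ 2) • (GpW i c *ᵥ f)) E := by
  rw [LinearMap.smul_apply, LinearMap.restrictScalars_apply, GpCubeY_one_liftY i c par hpar, liftY_smul]

omit [CompleteSpace 𝔸] in
/-- `∇_μ(g ⊗ E) = (η⁻¹∂_μ g) ⊗ E` at `U = 1` (`∂_μ` = N03's periodic forward difference `dT`). [cite: Balaban1985BackgroundPropagators, (3.3) p.390, Cor. 3.5 p.407] -/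
theorem gradLetterF_one_liftY (η : ℝ) (μ : Fin (d + 1)) (g : SiteY i → ℝ) (E : 𝔸) :
    gradLetterF (shiftY i) (fun _ _ => (1 : 𝔸ˣ)) ((η : ℂ)⁻¹) μ (liftY g E) = liftY (η⁻¹ • (dT (toKT i).NB μ *ᵥ g)) E := by
  funext x
  show ((η : ℂ)⁻¹) • covD (shiftY i) (fun _ _ => (1 : 𝔸ˣ)) μ (liftY g E) x = _
  rw [covD, R_one, liftY_apply, liftY_apply, liftY_apply, Pi.smul_apply, dT_mulVec, smul_eq_mul, ← sub_smul,
    ← Complex.ofReal_sub, smul_smul, ← Complex.ofReal_inv, ← Complex.ofReal_mul]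
  rfl

omit [CompleteSpace 𝔸] in
/-- `∇*_μ(g ⊗ E) = (η⁻¹∂ᵀ_μ g) ⊗ E` at `U = 1` (`∂ᵀ_μ = ∂_μᵀ` the backward difference, `shiftMat_neg`). [cite: Balaban1985BackgroundPropagators, (3.8) p.392, Cor. 3.5 p.407] -/
theorem gradLetterB_one_liftY (η : ℝ) (μ : Fin (d + 1)) (g : SiteY i → ℝ) (E : 𝔸) :
    gradLetterB (shiftY i) (fun _ _ => (1 : 𝔸ˣ)) ((η : ℂ)⁻¹) μ (liftY g E) = liftY (η⁻¹ • ((dT (toKT i).NB μ)ᵀ *ᵥ g)) E := by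
  have hT : (dT (toKT i).NB μ)ᵀ = shiftMat (toKT i).NB (-unitVec μ) - 1 := by
    rw [dT, Matrix.transpose_sub, Matrix.transpose_one, ← shiftMat_neg]
  funext x
  show ((η : ℂ)⁻¹) • covDstar (shiftY i) (fun _ _ => (1 : 𝔸ˣ)) μ (liftY g E) x = _
  have hs : (shiftY i μ).symm x = tshift (toKT i).NB (-unitVec μ) x := tshift_symm_apply _ _ _
  rw [covDstar, inv_one, R_one, liftY_apply, liftY_apply, liftY_apply, Pi.smul_apply, hT, Matrix.sub_mulVec, Pi.sub_apply,
    shiftMat_mulVec, Matrix.one_mulVec, hs, smul_eq_mul, ← sub_smul, ← Complex.ofReal_sub, smul_smul, ← Complex.ofReal_inv, ← Complex.ofReal_mul]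

/-- the majorant reshaping `|η²|·C·L^{2n} = C·(Lⁿη)²` and `|η|·C·Lⁿ = C·(Lⁿη)` (`η > 0`). [cite: Balaban1985BackgroundPropagators, (3.41) p.397, bookkeeping] -/
theorem len_reshape (C δ : ℝ) (a a' : BlkCubeY i c) :
    |(kGeo i).eta ^ 2| * (C * ((ℓ : ℝ) + 1) ^ (2 * a.1.1) * Real.exp (-(δ * (geoCK i c).dist a a'))) =
      C * (geoCK i c).len a ^ 2 * Real.exp (-(δ * (geoCK i c).dist a a')) ∧
    |(kGeo i).eta| * (C * ((ℓ : ℝ) + 1) ^ a.1.1 * Real.exp (-(δ * (geoCK i c).dist a a'))) =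
      C * (geoCK i c).len a * Real.exp (-(δ * (geoCK i c).dist a a')) := by
  have hη := geoCK_eta_pos i c
  rw [geoCK_eta] at hη
  rw [abs_of_pos (pow_pos hη 2), abs_of_pos hη, geoCK_len, pow_mul']
  constructor <;> ring

/-- ★★ **BINDER `h342_1` AT THE CUBE**: from r05's scalar (3.42)₁ for `G′_□(1)` (`thm31_cubeW_flat_first`: `toLin' GpCubeW ≺ C·L^{2n}·e^{−δd}` over the cube blocks),
`Gp = conj b(η²G′_□(1)) ≺ C·(Lⁿη)²·e^{−δd}`. [cite: Balaban1985BackgroundPropagators, Thm 3.1 (3.42)₁ p.397, Cor. 3.5 p.407, p.409 l.1–5; Balaban1984PropagatorsII, (2.51) p.232, Prop. 2.2 (2.67) p.234] -/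
theorem h342_1_cube (hpar : ∀ z w, par (fun _ _ => 1) z w = 1) {C δ : ℝ} (Rr : ℝ) (H : Prop)
    (h₁ : HasMajorant (g := B6Geom246MultiLevelTorusL0.geomT (cubeFamY i c)) (blkCubeY i c) (Matrix.toLin' (GpW i c))
      (fun y y' => C * ((ℓ : ℝ) + 1) ^ (2 * y.1.1) * Real.exp (-(δ * (B6Geom246MultiLevelTorusL0.geomT (cubeFamY i c)).dist y y')))) :
    HasMajorant (g := toB6 (geoCK i c) Rr H) (fun p : SiteY i × ι => blkCubeY i c p.1) (GpK b i c par)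
      (fun a a' => C * (geoCK i c).len a ^ 2 * Real.exp (-(δ * (geoCK i c).dist a a'))) := by
  have hT := smul_GpCubeY_one_liftY i c par hpar
  have hm := hasMajorant_smul (g := toB6 (geoCK i c) Rr H) (blkCubeY i c) (hasMajorant_toB6_of_geomT i c Rr H h₁) ((kGeo i).eta ^ 2)
  rw [GpK]
  refine hasMajorant_mono (g := toB6 (geoCK i c) Rr H) _ (hasMajorant_conj_of_liftY b (g := toB6 (geoCK i c) Rr H) (blkCubeY i c) _ _ (fun f E => ?_) hm) fun a a' => ?_
  · rw [hT, LinearMap.smul_apply, Matrix.toLin'_apply]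
  · exact ((len_reshape i c C δ a a').1).le

/-- ★★ **BINDER `h342_2` AT THE CUBE, FORWARD BONDS** (`k = inl μ`): from r05's scalar (3.42)₂ (`thm31_cubeW_flat_second`: `toLin' (∂_μ·GpCubeW) ≺ C·Lⁿ·e^{−δd}`),
`conj b(∇_μ)·Gp ≺ C·(Lⁿη)·e^{−δd}`. [cite: Balaban1985BackgroundPropagators, Thm 3.1 (3.42)₂ p.397, Cor. 3.5 p.407, p.409; Balaban1984PropagatorsII, Prop. 2.2 (2.67)₂ p.234] -/
theorem h342_2_cube_inl (hpar : ∀ z w, par (fun _ _ => 1) z w = 1) {C δ : ℝ} (Rr : ℝ) (H : Prop) (μ : Fin (d + 1))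
    (h₂ : HasMajorant (g := B6Geom246MultiLevelTorusL0.geomT (cubeFamY i c)) (blkCubeY i c) (Matrix.toLin' (dT (toKT i).NB μ * GpW i c))
      (fun y y' => C * ((ℓ : ℝ) + 1) ^ y.1.1 * Real.exp (-(δ * (B6Geom246MultiLevelTorusL0.geomT (cubeFamY i c)).dist y y')))) :
    HasMajorant (g := toB6 (geoCK i c) Rr H) (fun p : SiteY i × ι => blkCubeY i c p.1)
      (conj b (diffLetter (shiftY i) (fun _ _ => (1 : 𝔸ˣ)) ((((geoCK i c).eta : ℂ))⁻¹) (Sum.inl μ)) * GpK b i c par)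
      (fun a a' => C * (geoCK i c).len a * Real.exp (-(δ * (geoCK i c).dist a a'))) := by
  have hη := eta_ne_zero i
  have hm := hasMajorant_smul (g := toB6 (geoCK i c) Rr H) (blkCubeY i c) (hasMajorant_toB6_of_geomT i c Rr H h₂) ((kGeo i).eta)
  rw [diffLetter_inl, GpK, ← B9Eq352DivFormLetters.conj_mul, geoCK_eta]
  refine hasMajorant_mono (g := toB6 (geoCK i c) Rr H) _ (hasMajorant_conj_of_liftY b (g := toB6 (geoCK i c) Rr H) (blkCubeY i c) _ _ (fun f E => ?_) hm) fun a a' => ?_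
  · rw [Module.End.mul_apply, smul_GpCubeY_one_liftY i c par hpar, gradLetterF_one_liftY, LinearMap.smul_apply, Matrix.toLin'_apply,
      Matrix.mulVec_smul, smul_smul, ← Matrix.mulVec_mulVec]
    congr 1
    rw [show (kGeo i).eta⁻¹ * (kGeo i).eta ^ 2 = (kGeo i).eta by field_simp]
  · exact ((len_reshape i c C δ a a').2).le

/-- ★★ **BINDER `h342_3` AT THE CUBE, BACKWARD BONDS** (`k = inr μ`): from r05's scalar (3.42)₃ (`thm31_cubeW_flat_third`: `toLin' (GpCubeW·∂_μᵀ) ≺ C·Lⁿ·e^{−δd}`),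
`Gp·conj b(−∇*_μ) ≺ C·(Lⁿη)·e^{−δd}`. [cite: Balaban1985BackgroundPropagators, Thm 3.1 (3.42)₃ p.397, Cor. 3.5 p.407, p.409; Balaban1984PropagatorsII, Prop. 2.2 (2.67)₃ p.234] -/
theorem h342_3_cube_inr (hpar : ∀ z w, par (fun _ _ => 1) z w = 1) {C δ : ℝ} (Rr : ℝ) (H : Prop) (μ : Fin (d + 1))
    (h₃ : HasMajorant (g := B6Geom246MultiLevelTorusL0.geomT (cubeFamY i c)) (blkCubeY i c) (Matrix.toLin' (GpW i c * (dT (toKT i).NB μ)ᵀ))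
      (fun y y' => C * ((ℓ : ℝ) + 1) ^ y.1.1 * Real.exp (-(δ * (B6Geom246MultiLevelTorusL0.geomT (cubeFamY i c)).dist y y')))) :
    HasMajorant (g := toB6 (geoCK i c) Rr H) (fun p : SiteY i × ι => blkCubeY i c p.1)
      (GpK b i c par * conj b (diffLetter (shiftY i) (fun _ _ => (1 : 𝔸ˣ)) ((((geoCK i c).eta : ℂ))⁻¹) (Sum.inr μ)))
      (fun a a' => C * (geoCK i c).len a * Real.exp (-(δ * (geoCK i c).dist a a'))) := by
  have hη := eta_ne_zero i
  have hm := hasMajorant_neg (g := toB6 (geoCK i c) Rr H) (blkCubeY i c) (hasMajorant_smul (g := toB6 (geoCK i c) Rr H) (blkCubeY i c) (hasMajorant_toB6_of_geomT i c Rr H h₃) ((kGeo i).eta))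
  rw [diffLetter_inr, GpK, ← B9Eq352DivFormLetters.conj_mul, geoCK_eta]
  refine hasMajorant_mono (g := toB6 (geoCK i c) Rr H) _ (hasMajorant_conj_of_liftY b (g := toB6 (geoCK i c) Rr H) (blkCubeY i c) _ _ (fun f E => ?_) hm) fun a a' => ?_
  · rw [Module.End.mul_apply, LinearMap.neg_apply, gradLetterB_one_liftY, map_neg, smul_GpCubeY_one_liftY i c par hpar, ← liftY_neg,
      LinearMap.neg_apply, LinearMap.smul_apply, Matrix.toLin'_apply, Matrix.mulVec_smul, smul_smul, ← Matrix.mulVec_mulVec]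
    congr 2
    rw [show (kGeo i).eta ^ 2 * (kGeo i).eta⁻¹ = (kGeo i).eta by field_simp]
  · exact ((len_reshape i c C δ a a').2).le

/-- ★ **BINDER `h342_2` AT THE CUBE, BACKWARD BONDS** (`k = inr μ`: `∇*_μ·G′`, not among print's three): from a scalar block majorant of `∂_μᵀ·GpCubeW` of the same
shape (§5 derives it from M5.1a's forward-left entry by the one-step shift),
`conj b(−∇*_μ)·Gp ≺ C·(Lⁿη)·e^{−δd}`. [cite: Balaban1985BackgroundPropagators, Thm 3.1 (3.42) p.397 (∇_U both orientations, (3.3)/(3.8)), Cor. 3.5 p.407, p.409] -/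
theorem h342_2_cube_inr (hpar : ∀ z w, par (fun _ _ => 1) z w = 1) {C δ : ℝ} (Rr : ℝ) (H : Prop) (μ : Fin (d + 1))
    (h₂' : HasMajorant (g := toB6 (geoCK i c) Rr H) (blkCubeY i c) (Matrix.toLin' ((dT (toKT i).NB μ)ᵀ * GpW i c))
      (fun y y' => C * ((ℓ : ℝ) + 1) ^ y.1.1 * Real.exp (-(δ * (geoCK i c).dist y y')))) :
    HasMajorant (g := toB6 (geoCK i c) Rr H) (fun p : SiteY i × ι => blkCubeY i c p.1)
      (conj b (diffLetter (shiftY i) (fun _ _ => (1 : 𝔸ˣ)) ((((geoCK i c).eta : ℂ))⁻¹) (Sum.inr μ)) * GpK b i c par)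
      (fun a a' => C * (geoCK i c).len a * Real.exp (-(δ * (geoCK i c).dist a a'))) := by
  have hη := eta_ne_zero i
  have hm := hasMajorant_neg (g := toB6 (geoCK i c) Rr H) (blkCubeY i c) (hasMajorant_smul (g := toB6 (geoCK i c) Rr H) (blkCubeY i c) h₂' ((kGeo i).eta))
  rw [diffLetter_inr, GpK, ← B9Eq352DivFormLetters.conj_mul, geoCK_eta]
  refine hasMajorant_mono (g := toB6 (geoCK i c) Rr H) _ (hasMajorant_conj_of_liftY b (g := toB6 (geoCK i c) Rr H) (blkCubeY i c) _ _ (fun f E => ?_) hm) fun a a' => ?_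
  · rw [Module.End.mul_apply, smul_GpCubeY_one_liftY i c par hpar, LinearMap.neg_apply, gradLetterB_one_liftY, ← liftY_neg,
      LinearMap.neg_apply, LinearMap.smul_apply, Matrix.toLin'_apply, Matrix.mulVec_smul, smul_smul, ← Matrix.mulVec_mulVec]
    congr 2
    rw [show (kGeo i).eta⁻¹ * (kGeo i).eta ^ 2 = (kGeo i).eta by field_simp]
  · exact ((len_reshape i c C δ a a').2).le

/-- ★ **BINDER `h342_3` AT THE CUBE, FORWARD BONDS** (`k = inl μ`: `G′·∇_μ`, not among print's three): from a scalar block majorant of `GpCubeW·∂_μ` (§5 derives it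
from M5.1a's backward-right entry by the one-step shift), `Gp·conj b(∇_μ) ≺ C·(Lⁿη)·e^{−δd}`. [cite: Balaban1985BackgroundPropagators, Thm 3.1 (3.42) p.397, Cor. 3.5 p.407, p.409] -/
theorem h342_3_cube_inl (hpar : ∀ z w, par (fun _ _ => 1) z w = 1) {C δ : ℝ} (Rr : ℝ) (H : Prop) (μ : Fin (d + 1))
    (h₃' : HasMajorant (g := toB6 (geoCK i c) Rr H) (blkCubeY i c) (Matrix.toLin' (GpW i c * dT (toKT i).NB μ))
      (fun y y' => C * ((ℓ : ℝ) + 1) ^ y.1.1 * Real.exp (-(δ * (geoCK i c).dist y y')))) :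
    HasMajorant (g := toB6 (geoCK i c) Rr H) (fun p : SiteY i × ι => blkCubeY i c p.1)
      (GpK b i c par * conj b (diffLetter (shiftY i) (fun _ _ => (1 : 𝔸ˣ)) ((((geoCK i c).eta : ℂ))⁻¹) (Sum.inl μ)))
      (fun a a' => C * (geoCK i c).len a * Real.exp (-(δ * (geoCK i c).dist a a'))) := by
  have hη := eta_ne_zero i
  have hm := hasMajorant_smul (g := toB6 (geoCK i c) Rr H) (blkCubeY i c) h₃' ((kGeo i).eta)
  rw [diffLetter_inl, GpK, ← B9Eq352DivFormLetters.conj_mul, geoCK_eta]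
  refine hasMajorant_mono (g := toB6 (geoCK i c) Rr H) _ (hasMajorant_conj_of_liftY b (g := toB6 (geoCK i c) Rr H) (blkCubeY i c) _ _ (fun f E => ?_) hm) fun a a' => ?_
  · rw [Module.End.mul_apply, gradLetterF_one_liftY, smul_GpCubeY_one_liftY i c par hpar, LinearMap.smul_apply, Matrix.toLin'_apply,
      Matrix.mulVec_smul, smul_smul, ← Matrix.mulVec_mulVec]
    congr 1
    rw [show (kGeo i).eta ^ 2 * (kGeo i).eta⁻¹ = (kGeo i).eta by field_simp]
  · exact ((len_reshape i c C δ a a').2).le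

end Entries

/-! ## §5  The two remaining orientations `∇*_μG′_□ = −σ_{−e_μ}(∇_μG′_□)`, `G′_□∇_μ = −(G′_□∇*_μ)σ_{e_μ}` by the one-step shift in [4]'s majorant calculus -/

section Shift

variable (i : KIdx d ℓ hd hL b₀ b₁) (c : ↥(cubes (toKT i).D.toDomains))

/-- ★ **THE ONE-STEP TRANSLATION HAS THE BLOCK MAJORANT `e^{θ}·e^{−θd}`** (`θ ≥ 0`): a source in the block `y′` translated by `±e_μ` lands in blocks at
graph distance `≤ 1` from `y′` (FILE 5a's stencil). [cite: Balaban1984PropagatorsII, (2.51) p.232, (2.46) p.231; Balaban1985BackgroundPropagators, (3.60) p.402 (stencil)] -/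
theorem hasMajorant_shiftMat (Rr : ℝ) (H : Prop) {θ : ℝ} (hθ : 0 ≤ θ) (μ : Fin (d + 1)) (sgn : ℤ) (hs : sgn = 1 ∨ sgn = -1) :
    HasMajorant (g := toB6 (geoCK i c) Rr H) (blkCubeY i c) (Matrix.toLin' (shiftMat (toKT i).NB (sgn • unitVec μ)))
      (fun a a' => Real.exp θ * Real.exp (-(θ * (geoCK i c).dist a a'))) := by
  intro y' f B hf x
  rw [Matrix.toLin'_apply, shiftMat_mulVec]
  by_cases hb : blkCubeY i c (tshift (toKT i).NB (sgn • unitVec μ) x) = y'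
  · have hd1 : (geoCK i c).dist (blkCubeY i c x) y' ≤ 1 := by
      rw [← hb]
      exact B9CubeGeometryInputs.dist_blkCubeY_le_one_of_near i c (B9CubeGeometryInputs.torusSupNorm_sub_tshift_unit_le_one i x μ sgn hs)
    have h1 : (1 : ℝ) ≤ Real.exp θ * Real.exp (-(θ * (geoCK i c).dist (blkCubeY i c x) y')) := by
      rw [← Real.exp_add]
      exact Real.one_le_exp (by nlinarith)
    calc |f (tshift (toKT i).NB (sgn • unitVec μ) x)| ≤ B := hf.bound _ hb
      _ = 1 * B := (one_mul B).symm
      _ ≤ _ := mul_le_mul_of_nonneg_right h1 hf.nonneg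
  · rw [hf.off _ hb, abs_zero]
    exact mul_nonneg (mul_nonneg (Real.exp_nonneg _) (Real.exp_nonneg _)) hf.nonneg

/-- `σ_{e}(σ_{−e} x) = x` and `σ_{−e}(σ_{e} x) = x` on the torus. [cite: Balaban1983RegularityDecay, p.572, dictionary] -/
theorem tshift_neg_tshift (v : Fin (d + 1) → ℤ) (x : SiteY i) :
    tshift (toKT i).NB v (tshift (toKT i).NB (-v) x) = x ∧ tshift (toKT i).NB (-v) (tshift (toKT i).NB v x) = x := by
  constructor
  · rw [B6MultiLevelTorusOperator.tshift_tshift, neg_add_cancel, B6MultiLevelTorusOperator.tshift_zero]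
  · rw [B6MultiLevelTorusOperator.tshift_tshift, add_neg_cancel, B6MultiLevelTorusOperator.tshift_zero]

/-- `∂_μᵀ·M = −σ_{−e_μ}·(∂_μ·M)` as operators (`∂_μᵀ = σ_{−e_μ} − 1 = −σ_{−e_μ}(σ_{e_μ} − 1)`). [cite: Balaban1984PropagatorsII, (2.67) p.234, dictionary] -/
theorem toLin'_transpose_dT_mul (μ : Fin (d + 1)) (M : Matrix (SiteY i) (SiteY i) ℝ) :
    Matrix.toLin' ((dT (toKT i).NB μ)ᵀ * M) =
      Matrix.toLin' (shiftMat (toKT i).NB ((-1 : ℤ) • unitVec μ)) * -Matrix.toLin' (dT (toKT i).NB μ * M) := by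
  have hT : (dT (toKT i).NB μ)ᵀ = shiftMat (toKT i).NB (-unitVec μ) - 1 := by
    rw [dT, Matrix.transpose_sub, Matrix.transpose_one, ← shiftMat_neg]
  refine LinearMap.ext fun f => funext fun x => ?_
  rw [Matrix.toLin'_apply, Module.End.mul_apply, LinearMap.neg_apply, Matrix.toLin'_apply, Matrix.toLin'_apply, ← Matrix.mulVec_mulVec, hT,
    Matrix.sub_mulVec, Pi.sub_apply, shiftMat_mulVec, Matrix.one_mulVec, neg_one_smul, Matrix.mulVec_neg, Pi.neg_apply, shiftMat_mulVec,
    ← Matrix.mulVec_mulVec, dT_mulVec, (tshift_neg_tshift i (unitVec μ) _).1]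
  ring

/-- `M·∂_μ = −(M·∂_μᵀ)·σ_{e_μ}` as operators (`∂_μᵀσ_{e_μ} = −∂_μ`). [cite: Balaban1984PropagatorsII, (2.67) p.234, dictionary] -/
theorem toLin'_mul_dT (μ : Fin (d + 1)) (M : Matrix (SiteY i) (SiteY i) ℝ) :
    Matrix.toLin' (M * dT (toKT i).NB μ) =
      -Matrix.toLin' (M * (dT (toKT i).NB μ)ᵀ) * Matrix.toLin' (shiftMat (toKT i).NB ((1 : ℤ) • unitVec μ)) := by
  have hT : (dT (toKT i).NB μ)ᵀ = shiftMat (toKT i).NB (-unitVec μ) - 1 := by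
    rw [dT, Matrix.transpose_sub, Matrix.transpose_one, ← shiftMat_neg]
  have hkey : ∀ f : SiteY i → ℝ, (dT (toKT i).NB μ)ᵀ *ᵥ (shiftMat (toKT i).NB (unitVec μ) *ᵥ f) = -(dT (toKT i).NB μ *ᵥ f) := by
    intro f; funext y
    rw [hT, Matrix.sub_mulVec, Pi.sub_apply, shiftMat_mulVec, Matrix.one_mulVec, shiftMat_mulVec, shiftMat_mulVec, Pi.neg_apply, dT_mulVec,
      (tshift_neg_tshift i (unitVec μ) y).1]
    ring
  refine LinearMap.ext fun f => ?_
  rw [Matrix.toLin'_apply, Module.End.mul_apply, LinearMap.neg_apply, Matrix.toLin'_apply, Matrix.toLin'_apply, ← Matrix.mulVec_mulVec,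
    ← Matrix.mulVec_mulVec, one_smul, hkey, Matrix.mulVec_neg, neg_neg]

/-- ★ **SHIFT ∘ WEIGHTED KERNEL** ([4]'s majorant calculus: (2.52) product, p. 398 scale transfer of the middle weight, (2.54) split, (2.63) one-step chain):
`S ≺ r·e^{−δd}` and `Y ≺ A·w(a)·e^{−δd}` with `e^{−αδd(a,c)}w(c) ≤ Λw(a)`, triangle, `d ≥ 0`, (2.61) at `((1−α)δ, α′)` ⟹
`S·Y ≺ r·A·Λ·c₁((1−α)δ,α′)²·w(a)·e^{−(1−α′)(1−α)δd}`. [cite: Balaban1984PropagatorsII, (2.52)–(2.55) p.232–233, (2.60)–(2.63) p.234; Balaban1985BackgroundPropagators, p.398] -/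
theorem hasMajorant_shift_mul_weighted {X : Type} (Rr : ℝ) (H : Prop) (blk : X → BlkCubeY i c) (dB : ℕ) {δ α α' r A Λ : ℝ}
    (w : BlkCubeY i c → ℝ) (hr : 0 ≤ r) (hA : 0 ≤ A) (hΛ : 0 ≤ Λ) (hw : ∀ a, 0 ≤ w a) (hαδ : 0 ≤ α * δ) (hδ' : 0 ≤ (1 - α) * δ)
    (hα'1 : α' ≤ 1) (htri : B6RandomWalk.Triangle254 (toB6 (geoCK i c) Rr H))
    (hPΛ : ∀ a b : BlkCubeY i c, Real.exp (-(α * δ * (geoCK i c).dist a b)) * w b ≤ Λ * w a)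
    (h261 : B6RandomWalk.Ineq261 dB (toB6 (geoCK i c) Rr H) ((1 - α) * δ) α')
    {S Y : Module.End ℝ (X → ℝ)}
    (hS : HasMajorant (g := toB6 (geoCK i c) Rr H) blk S (fun a a' => r * Real.exp (-(δ * (geoCK i c).dist a a'))))
    (hY : HasMajorant (g := toB6 (geoCK i c) Rr H) blk Y (fun a a' => A * w a * Real.exp (-(δ * (geoCK i c).dist a a')))) :
    HasMajorant (g := toB6 (geoCK i c) Rr H) blk (S * Y)
      (fun a a' => r * A * Λ * B6.c1 dB ((1 - α) * δ) α' ^ 2 * w a * Real.exp (-((1 - α') * ((1 - α) * δ) * (geoCK i c).dist a a'))) := by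
  have hdnn := (B9CubeGeometryInputs.geoCK_dist_axioms i c Rr H).1
  have hK₂ : ∀ a a' : BlkCubeY i c, 0 ≤ A * w a * Real.exp (-(δ * (geoCK i c).dist a a')) := fun a a' =>
    mul_nonneg (mul_nonneg hA (hw a)) (Real.exp_nonneg _)
  have h263 := B6RandomWalk.ineq263_of_261 dB (toB6 (geoCK i c) Rr H) ((1 - α) * δ) α' htri hδ' hα'1 h261 1
  refine hasMajorant_mono (g := toB6 (geoCK i c) Rr H) _ (B6RandomWalk.hasMajorant_mul (g := toB6 (geoCK i c) Rr H) blk hS hY hK₂) fun a b => ?_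
  -- termwise: scale transfer of `w` from the middle point to `a`, lower the right rate to `(1−α)δ`
  have hterm : ∀ e : BlkCubeY i c, r * Real.exp (-(δ * (geoCK i c).dist a e)) * (A * w e * Real.exp (-(δ * (geoCK i c).dist e b))) ≤
      r * A * Λ * w a * (Real.exp (-((1 - α) * δ * (geoCK i c).dist a e)) * Real.exp (-((1 - α) * δ * (geoCK i c).dist e b))) := by
    intro e
    have hsplit : Real.exp (-(δ * (geoCK i c).dist a e)) = Real.exp (-(α * δ * (geoCK i c).dist a e)) * Real.exp (-((1 - α) * δ * (geoCK i c).dist a e)) := by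
      rw [← Real.exp_add]; ring_nf
    have hlow : Real.exp (-(δ * (geoCK i c).dist e b)) ≤ Real.exp (-((1 - α) * δ * (geoCK i c).dist e b)) :=
      Real.exp_le_exp.2 (by nlinarith [hdnn e b])
    have h1 := hPΛ a e
    calc r * Real.exp (-(δ * (geoCK i c).dist a e)) * (A * w e * Real.exp (-(δ * (geoCK i c).dist e b)))
        = r * A * (Real.exp (-(α * δ * (geoCK i c).dist a e)) * w e) * Real.exp (-((1 - α) * δ * (geoCK i c).dist a e)) *
            Real.exp (-(δ * (geoCK i c).dist e b)) := by rw [hsplit]; ring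
      _ ≤ r * A * (Λ * w a) * Real.exp (-((1 - α) * δ * (geoCK i c).dist a e)) * Real.exp (-((1 - α) * δ * (geoCK i c).dist e b)) := by
          have hpre : 0 ≤ r * A := mul_nonneg hr hA
          have hx1 : 0 ≤ Real.exp (-((1 - α) * δ * (geoCK i c).dist a e)) := Real.exp_nonneg _
          have hΛw : 0 ≤ Λ * w a := mul_nonneg hΛ (hw a)
          calc r * A * (Real.exp (-(α * δ * (geoCK i c).dist a e)) * w e) * Real.exp (-((1 - α) * δ * (geoCK i c).dist a e)) *
                Real.exp (-(δ * (geoCK i c).dist e b))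
              ≤ r * A * (Λ * w a) * Real.exp (-((1 - α) * δ * (geoCK i c).dist a e)) * Real.exp (-(δ * (geoCK i c).dist e b)) :=
                mul_le_mul_of_nonneg_right (mul_le_mul_of_nonneg_right (mul_le_mul_of_nonneg_left h1 hpre) hx1) (Real.exp_nonneg _)
            _ ≤ _ := mul_le_mul_of_nonneg_left hlow (mul_nonneg (mul_nonneg hpre hΛw) hx1)
      _ = _ := by ring
  have hchain := h263 a b
  simp only [B6RandomWalk.chain] at hchain
  calc ∑ e, r * Real.exp (-(δ * (geoCK i c).dist a e)) * (A * w e * Real.exp (-(δ * (geoCK i c).dist e b)))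
      ≤ ∑ e, r * A * Λ * w a * (Real.exp (-((1 - α) * δ * (geoCK i c).dist a e)) * Real.exp (-((1 - α) * δ * (geoCK i c).dist e b))) :=
        Finset.sum_le_sum fun e _ => hterm e
    _ = r * A * Λ * w a * ∑ e, Real.exp (-((1 - α) * δ * (geoCK i c).dist a e)) * Real.exp (-((1 - α) * δ * (geoCK i c).dist e b)) := by
        rw [Finset.mul_sum]
    _ ≤ r * A * Λ * w a * (B6.c1 dB ((1 - α) * δ) α' ^ (1 + 1) * Real.exp (-((1 - α') * ((1 - α) * δ) * (geoCK i c).dist a b))) :=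
        mul_le_mul_of_nonneg_left hchain (mul_nonneg (mul_nonneg (mul_nonneg hr hA) hΛ) (hw a))
    _ = _ := by ring

/-- the scale transfer of the level weight `Lⁿ` is that of the length `Lⁿη` (FILE 5a's `hST_geoCK`, first component) divided by `η`.
[cite: Balaban1985BackgroundPropagators, p.398 remark after (3.47), bookkeeping] -/
theorem transfer_pow_of_scaleTransfer {δ α Λ : ℝ} (hST : B9Ineq347.ScaleTransfer (geoCK i c) δ α Λ (fun a => (geoCK i c).len a)) :
    ∀ a b : BlkCubeY i c, Real.exp (-(α * δ * (geoCK i c).dist a b)) * ((ℓ : ℝ) + 1) ^ b.1.1 ≤ Λ * ((ℓ : ℝ) + 1) ^ a.1.1 := by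
  intro a b
  have hη := geoCK_eta_pos i c
  have h := hST a b
  simp only [geoCK_len] at h
  have h' : (Real.exp (-(α * δ * (geoCK i c).dist a b)) * ((ℓ : ℝ) + 1) ^ b.1.1) * (kGeo i).eta ≤ (Λ * ((ℓ : ℝ) + 1) ^ a.1.1) * (kGeo i).eta := by
    calc (Real.exp (-(α * δ * (geoCK i c).dist a b)) * ((ℓ : ℝ) + 1) ^ b.1.1) * (kGeo i).eta
        = Real.exp (-(α * δ * (geoCK i c).dist a b)) * (((ℓ : ℝ) + 1) ^ b.1.1 * (kGeo i).eta) := by ring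
      _ ≤ Λ * (((ℓ : ℝ) + 1) ^ a.1.1 * (kGeo i).eta) := h
      _ = _ := by ring
  exact le_of_mul_le_mul_right h' hη

/-- ★★ **THE BACKWARD-LEFT ENTRY `∇*_μG′_□(1)` FROM THE FORWARD-LEFT ONE** (M5.1a's `thm31_cubeW_flat_second` read over `geoCK`): with the scale transfer of
`Lⁿ` at `(δ, α, Λ)`, triangle, (2.61) at `((1−α)δ, α′)`: `toLin' (∂_μᵀ·GpCubeW) ≺ (e^{δ}·C·Λ·c₁²)·Lⁿ·e^{−(1−α′)(1−α)δd}`.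
[cite: Balaban1985BackgroundPropagators, Thm 3.1 (3.42) p.397 (∇_U, (3.3)/(3.8)), Cor. 3.5 p.407, p.409; Balaban1984PropagatorsII, Prop. 2.2 (2.67)₂ p.234, (2.52)–(2.63) pp.232–234] -/
theorem hasMajorant_transpose_dT_mul_GpW (Rr : ℝ) (H : Prop) (dB : ℕ) {C δ α α' Λ : ℝ} (hC : 0 ≤ C) (hδ : 0 ≤ δ) (hΛ : 0 ≤ Λ)
    (hαδ : 0 ≤ α * δ) (hδ' : 0 ≤ (1 - α) * δ) (hα'1 : α' ≤ 1) (htri : B6RandomWalk.Triangle254 (toB6 (geoCK i c) Rr H))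
    (hPΛ : ∀ a b : BlkCubeY i c, Real.exp (-(α * δ * (geoCK i c).dist a b)) * ((ℓ : ℝ) + 1) ^ b.1.1 ≤ Λ * ((ℓ : ℝ) + 1) ^ a.1.1)
    (h261 : B6RandomWalk.Ineq261 dB (toB6 (geoCK i c) Rr H) ((1 - α) * δ) α') (μ : Fin (d + 1))
    (h₂ : HasMajorant (g := toB6 (geoCK i c) Rr H) (blkCubeY i c) (Matrix.toLin' (dT (toKT i).NB μ * GpW i c))
      (fun y y' => C * ((ℓ : ℝ) + 1) ^ y.1.1 * Real.exp (-(δ * (geoCK i c).dist y y')))) :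
    HasMajorant (g := toB6 (geoCK i c) Rr H) (blkCubeY i c) (Matrix.toLin' ((dT (toKT i).NB μ)ᵀ * GpW i c))
      (fun y y' => Real.exp δ * C * Λ * B6.c1 dB ((1 - α) * δ) α' ^ 2 * ((ℓ : ℝ) + 1) ^ y.1.1 *
        Real.exp (-((1 - α') * ((1 - α) * δ) * (geoCK i c).dist y y'))) := by
  rw [toLin'_transpose_dT_mul]
  exact hasMajorant_shift_mul_weighted i c Rr H (blkCubeY i c) dB (fun a : BlkCubeY i c => ((ℓ : ℝ) + 1) ^ a.1.1) (Real.exp_nonneg δ) hC hΛ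
    (fun a => by positivity) hαδ hδ' hα'1 htri hPΛ h261 (hasMajorant_shiftMat i c Rr H hδ μ (-1) (Or.inr rfl))
    (hasMajorant_neg (g := toB6 (geoCK i c) Rr H) (blkCubeY i c) h₂)

/-- ★★ **THE FORWARD-RIGHT ENTRY `G′_□(1)∇_μ` FROM THE BACKWARD-RIGHT ONE** (M5.1a's `thm31_cubeW_flat_third` read over `geoCK`): with triangle and (2.61) at
`(δ, α)` (no scale transfer: the weight sits at the left point): `toLin' (GpCubeW·∂_μ) ≺ (C·c₁·e^{(1−α)δ})·Lⁿ·e^{−(1−α)δd}` (`majorant_G0_mul_265`).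
[cite: Balaban1985BackgroundPropagators, Thm 3.1 (3.42) p.397, Cor. 3.5 p.407, p.409; Balaban1984PropagatorsII, Prop. 2.2 (2.67)₃ p.234, (2.65) p.234, (2.52)–(2.55) pp.232–233] -/
theorem hasMajorant_GpW_mul_dT (Rr : ℝ) (H : Prop) (dB : ℕ) {C δ α : ℝ} (hC : 0 ≤ C) (hδ' : 0 ≤ (1 - α) * δ)
    (htri : B6RandomWalk.Triangle254 (toB6 (geoCK i c) Rr H)) (h261 : B6RandomWalk.Ineq261 dB (toB6 (geoCK i c) Rr H) δ α) (μ : Fin (d + 1))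
    (h₃ : HasMajorant (g := toB6 (geoCK i c) Rr H) (blkCubeY i c) (Matrix.toLin' (GpW i c * (dT (toKT i).NB μ)ᵀ))
      (fun y y' => C * ((ℓ : ℝ) + 1) ^ y.1.1 * Real.exp (-(δ * (geoCK i c).dist y y')))) :
    HasMajorant (g := toB6 (geoCK i c) Rr H) (blkCubeY i c) (Matrix.toLin' (GpW i c * dT (toKT i).NB μ))
      (fun y y' => C * B6.c1 dB δ α * ((ℓ : ℝ) + 1) ^ y.1.1 * Real.exp ((1 - α) * δ) * Real.exp (-((1 - α) * δ * (geoCK i c).dist y y'))) := by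
  rw [toLin'_mul_dT]
  exact B6RandomWalk.majorant_G0_mul_265 (g := toB6 (geoCK i c) Rr H) (blkCubeY i c) dB δ α C (Real.exp ((1 - α) * δ))
    (fun a : BlkCubeY i c => ((ℓ : ℝ) + 1) ^ a.1.1) hC (fun a => by positivity) (Real.exp_nonneg _) hδ' htri h261
    (hasMajorant_neg (g := toB6 (geoCK i c) Rr H) (blkCubeY i c) h₃) (hasMajorant_shiftMat i c Rr H hδ' μ 1 (Or.inl rfl))

end Shift

end Literature.MathematicalPhysics.QuantumFieldTheory.Balaban1983to89.B9Cor35GpCubeInputsAtOne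

end
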